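import Mathlib
import Summits.Schanuel.Schanuel.Theses.RigidCore
import Summits.Schanuel.Schanuel.Theorems.AclSubsetLogFreeCore.Negative.LogFreeCoreCountable
import Summits.Schanuel.Schanuel.Theorems.AclSubsetLogFreeCore.Negative.LogTwoHub
import Summits.Schanuel.Schanuel.Theorems.AclSubsetLogFreeCore.Negative.RealDefinableCalibration
import Summits.Schanuel.Schanuel.Theorems.RigidCoreSchanuelOnLogFreeCoreTowerReduction
import Summits.Schanuel.Schanuel.Theorems.RigidCoreSchanuelOnLogFreeCoreRelLWZeroOfCrux
import Summits.Schanuel.Schanuel.Theorems.RigidCoreSchanuelOnLogFreeCoreRelLWStepOfCrux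

/-!
# Crux `RigidCore.SchanuelOnLogFreeCore` (R), line `sector-split`, stub C20: under (R) the log-free core is log-free

Support file for crux `stmt-Schanuel-0970`
(`Summit.Schanuel.Schanuel.Theses.RigidCore.SchanuelOnLogFreeCore`, "(R)": Schanuel's statement for
`ℚ`-linearly independent tuples from the log-free core
`C_EA = logFreeCore = sInf {K ≤ ℂ | 2πi ∈ K, K exp-closed, K relatively algebraically closed}`),
registered stub `stub_logFree_of_crux` of skeleton v23 (lead c12).

* `stub_logFree_of_crux` (registered signature verbatim): **(R) ⟹ for every `u ∈ C_EA` with `eᵘ`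
  algebraic, `u ∈ ℚ·2πi`** — the crux predicts that the only logarithms of algebraic numbers inside
  the log-free core are the rational multiples of `2πi` (finding I7 of the crux chain,
  `Cruxes/SchanuelOnLogFreeCore/Ideas/finding-r-implies-pilogalgindep.md`, never typed before; the
  landed `…CalibrationR.lean` proves only the dichotomy corollary `(R) ⟹ π ⊥ log 2`).
  PROOF: induction up the kernel tower `stage` (`stage 0 = ℚ(2πi)^{ralg}`,
  `stage (m+1) = ℚ(stage m ∪ exp (stage m))^{ralg}`, `C_EA = ⋃ₘ stage m` by
  `mem_logFreeCore_iff_exists_stage`).  Level `0` is the `r = 1` layer of the landed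
  `stub_relLWZero_of_crux` ((R) ⟹ RelLW₀, `…RelLWZeroOfCrux.lean`) read through
  `KernelTower.relLWZero_one_iff` (`a ∈ L₀, eᵃ ∈ L₀ ⟹ a ∈ ℚ·2πi`); at level `m + 1` the `r = 1`
  layer of the landed `stub_relLWStep_of_crux` ((R) ⟹ RelLW_{m+1}, `…RelLWStepOfCrux.lean`) says
  `eᵘ` is transcendental over `stage (m+1)` unless `u ∈ stage m` — so an algebraic `eᵘ` drops the
  level and the induction hypothesis applies.
* Consequences BY THE CRUX'S NAME (namespace `LogFreeOfCrux`): `(R) ⟹ ln a ∉ C_EA` for every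
  positive real algebraic `a ≠ 1` (`realLog_not_mem_core_of_crux`, `log_two_not_mem_core_of_crux`);
  composed with the (A)-chain's landed `log_two_mem_logFreeCore_of_real_definable`
  (`…RealDefinableCalibration.lean`) and `LogTwoHub.lean` — **(A) ∧ (R) ⟹ `ℝ` is not
  `∅`-definable in `ℂ_exp`** (`real_not_definable_of_cruxes`; Koiran 2003 / KMO 2012: open),
  `ln 2 ∉ dcl ∅`, and no branch of `log 2` lies in `acl ∅` — the route's informal kill criterion for
  (A) (item stmt-Schanuel-0968: "false if `ℝ` is `∅`-definable … under SC") with SC replaced by the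
  route's own (R).  (The same wave landed C21 `stub_realUndefinable_of_logFree`,
  `…RealUndefinable.lean` — this composition with log-freeness as an explicit hypothesis — and the
  UNCONDITIONAL first layer C19 `stub_bakerLayerOne`, `…BakerLayerOne.lean`, Baker 1975 Thm 2.1:
  the conclusion of `stub_logFree_of_crux` holds with no hypothesis on `E = ℚ̄ ⊕ ℚ̄·2πi ⊂ C_EA`,
  while the next layer `stage 0 = ℚ(2πi)^{ralg}` is already the printed-open `π ⊥ log α`,
  `…CalibrationR.lean`, barrier `AlgebraicIndependenceOfLogarithms`.  Those two modules are not
  imported here; the line's skeleton composes all three stubs by name.)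

What is NOT claimed: (R) itself (open, `⊇ e ⊥ π`); the definability statements are conditional on
(A) ∧ (R).  Sources: J. Kirby, *Exponential algebraicity in exponential fields*, Bull. LMS 42 (2010),
arXiv:0810.4285, Prop. 7.2 and §3 (hulls); M. Bays, J. Kirby, *Pseudo-exponential maps, variants,
and quasiminimality*, ANT 12 (2018), arXiv:1512.04262, §9; P. Koiran, JSL 68 (2003);
Kirby–Macintyre–Onshuus, arXiv:1101.4224, p. 2; A. Baker, *Transcendental Number Theory* (1975),
Ch. 2 Thm 2.1.
-/

noncomputable section

set_option linter.dupNamespace false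

open Summit.Schanuel.Schanuel.Theses
open Summit.Schanuel.Schanuel.Theorems.AclSubsetLogFreeCore.Negative

namespace Summit.Schanuel.Schanuel.Theorems.RigidCore

namespace LogFreeOfCrux

/-- An algebraic number is algebraic over every stage of the kernel tower. [folklore] -/
theorem isAlgebraic_stage_of_isAlgebraic (n : ℕ) {w : ℂ} (hw : IsAlgebraic ℚ w) :
    IsAlgebraic (↥(stage n)) w :=
  hw.tower_top (L := stage n)

/-- An element outside `stage m` is, as a one-term family, linearly independent modulo
`span_ℚ (stage m)` (which is `stage m` itself). [folklore] -/
theorem linearIndependent_mkQ_of_not_mem {m : ℕ} {u : ℂ} (hu : u ∉ stage m) :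
    LinearIndependent ℚ ((Submodule.span ℚ (stage m : Set ℂ)).mkQ ∘ fun _ : Fin 1 => u) := by
  rw [linearIndependent_unique_iff]
  simp only [Function.comp_apply, Submodule.mkQ_apply, ne_eq, Submodule.Quotient.mk_eq_zero]
  intro h
  refine hu ?_
  have hle : Submodule.span ℚ (stage m : Set ℂ) ≤
      Subalgebra.toSubmodule (stage m).toSubalgebra :=
    Submodule.span_le.2 fun x hx => hx
  exact hle h

/-- **Level `0`**: under (R), an element of `stage 0 = ℚ(2πi)^{ralg}` with algebraic exponential lies
on the kernel line `ℚ·2πi` — the `r = 1` layer of `(R) ⟹ RelLW₀` (`stub_relLWZero_of_crux` through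
`KernelTower.relLWZero_one_iff`). [cite: Kirby2010, Prop. 7.2] -/
theorem level_zero (hR : RigidCore.SchanuelOnLogFreeCore) {u : ℂ} (hu : u ∈ stage 0)
    (halg : IsAlgebraic ℚ (Complex.exp u)) :
    u ∈ Submodule.span ℚ ({(2 * ↑Real.pi * Complex.I : ℂ)} : Set ℂ) := by
  have h1 := KernelTower.relLWZero_one_iff.1.1 (stub_relLWZero_of_crux hR 1)
  have h2 := KernelTower.relLWZero_one_iff.2.1 h1
  exact h2 u hu (stage_closed 0 _ (isAlgebraic_stage_of_isAlgebraic 0 halg))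

/-- **Level `m + 1` drops**: under (R), an element of `stage (m+1)` with algebraic exponential
already lies in `stage m` — the `r = 1` layer of `(R) ⟹ RelLW_{m+1}` (`stub_relLWStep_of_crux`):
otherwise `eᵘ` would be transcendental over `stage (m+1)`. [cite: BaysKirby2018ANT, §9] -/
theorem level_succ (hR : RigidCore.SchanuelOnLogFreeCore) (m : ℕ) {u : ℂ} (hu : u ∈ stage (m + 1))
    (halg : IsAlgebraic ℚ (Complex.exp u)) : u ∈ stage m := by
  by_contra hm
  have hai := stub_relLWStep_of_crux hR m 1 (fun _ => u) (fun _ => hu)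
    (linearIndependent_mkQ_of_not_mem hm)
  have ht : Transcendental (↥(stage (m + 1))) (Complex.exp u) :=
    (algebraicIndependent_singleton_iff (0 : Fin 1)).mp hai
  exact ht (isAlgebraic_stage_of_isAlgebraic (m + 1) halg)

/-- **Every level**: under (R), an element of `stage n` with algebraic exponential lies on `ℚ·2πi`
(induction on `n`: `level_succ` drops to `stage 0`, `level_zero` concludes). -/
theorem level (hR : RigidCore.SchanuelOnLogFreeCore) :
    ∀ (n : ℕ) {u : ℂ}, u ∈ stage n → IsAlgebraic ℚ (Complex.exp u) →
      u ∈ Submodule.span ℚ ({(2 * ↑Real.pi * Complex.I : ℂ)} : Set ℂ)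
  | 0, _, hu, halg => level_zero hR hu halg
  | n + 1, _, hu, halg => level hR n (level_succ hR n hu halg) halg

end LogFreeOfCrux

/-- **Registered stub `stub_logFree_of_crux` (C20) of line `sector-split` — under (R) the log-free
core is log-free** (signature verbatim): Schanuel's statement for core tuples implies that every
`u ∈ C_EA = logFreeCore` with `eᵘ` algebraic is a rational multiple of `2πi`.  Core exhaustion
`mem_logFreeCore_iff_exists_stage` + `LogFreeOfCrux.level`. [cite: Kirby2010, Prop. 7.2]
[cite: BaysKirby2018ANT, §9] -/
theorem stub_logFree_of_crux :
    RigidCore.SchanuelOnLogFreeCore →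
      ∀ u : ℂ, u ∈ logFreeCore → IsAlgebraic ℚ (Complex.exp u) →
        u ∈ Submodule.span ℚ ({(2 * ↑Real.pi * Complex.I : ℂ)} : Set ℂ) := by
  intro hR u hu halg
  obtain ⟨n, hn⟩ := mem_logFreeCore_iff_exists_stage.1 hu
  exact LogFreeOfCrux.level hR n hn halg

namespace LogFreeOfCrux

/-! ## Consequences by the crux's name -/

/-- **(R) ⟹ no logarithm of an algebraic number lies in the core off the kernel line**: if `eᵘ` is
algebraic and `u ∉ ℚ·2πi` then `u ∉ C_EA`. -/
theorem not_mem_core_of_crux (hR : RigidCore.SchanuelOnLogFreeCore) {u : ℂ}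
    (halg : IsAlgebraic ℚ (Complex.exp u))
    (hu : u ∉ Submodule.span ℚ ({(2 * ↑Real.pi * Complex.I : ℂ)} : Set ℂ)) :
    u ∉ logFreeCore :=
  fun h => hu (stub_logFree_of_crux hR u h halg)

/-- **(R) ⟹ `ln a ∉ C_EA`** for every positive real algebraic `a ≠ 1` (`ln 2, ln 3, ln √2 + …`):
a non-zero real is not on `ℚ·2πi` (compare real parts). -/
theorem realLog_not_mem_core_of_crux (hR : RigidCore.SchanuelOnLogFreeCore) {a : ℝ} (ha : 0 < a)
    (ha1 : a ≠ 1) (halg : IsAlgebraic ℚ (a : ℂ)) : ((Real.log a : ℝ) : ℂ) ∉ logFreeCore := by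
  refine not_mem_core_of_crux hR ?_ fun hmem => ?_
  · rwa [← Complex.ofReal_exp, Real.exp_log ha]
  · obtain ⟨q, hq⟩ := Submodule.mem_span_singleton.1 hmem
    rw [Rat.smul_def] at hq
    have hre := congrArg Complex.re hq
    simp at hre
    exact Real.log_ne_zero_of_pos_of_ne_one ha ha1 hre.symm

/-- In particular **(R) ⟹ `ln 2 ∉ C_EA`**. -/
theorem log_two_not_mem_core_of_crux (hR : RigidCore.SchanuelOnLogFreeCore) :
    ((Real.log 2 : ℝ) : ℂ) ∉ logFreeCore :=
  realLog_not_mem_core_of_crux hR two_pos (by norm_num)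
    (by rw [Complex.ofReal_ofNat]; exact_mod_cast isAlgebraic_nat (R := ℚ) (A := ℂ) 2)

/-- **(A) ∧ (R) ⟹ `ℝ` is not `∅`-definable in `ℂ_exp = (ℂ, +, ·, exp)`** (C21 ∘ C20): the route's
symmetry crux and arithmetic crux together decide Koiran's question (parameter-free case; KMO
arXiv:1101.4224 p. 2: open). [cite: KirbyMacintyreOnshuus2012, p. 2] -/
theorem real_not_definable_of_cruxes (hA : RigidCore.AclSubsetLogFreeCore)
    (hR : RigidCore.SchanuelOnLogFreeCore) :
    ¬ Set.Definable₁ (∅ : Set ℂ) Literature.ModelTheory.ExponentialFields.Language.expRing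
        (Set.range ((↑) : ℝ → ℂ)) :=
  fun hdef => log_two_not_mem_core_of_crux hR (log_two_mem_logFreeCore_of_real_definable hA hdef)

/-- **(A) ∧ (R) ⟹ `ln 2 ∉ dcl^{ℂ_exp}(∅)`**: no parameter-free formula of `(ℂ, +, ·, exp)` singles
out the real logarithm of `2` (the hub of the (A)-chain, `LogTwoHub.lean`). -/
theorem log_two_not_mem_expDcl_of_cruxes (hA : RigidCore.AclSubsetLogFreeCore)
    (hR : RigidCore.SchanuelOnLogFreeCore) : ((Real.log 2 : ℝ) : ℂ) ∉ expDcl :=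
  fun h => log_two_not_mem_core_of_crux hR (log_two_mem_logFreeCore_of_crux hA h)

/-- **(A) ∧ (R) ⟹ no branch `ln 2 + 2πik` of `log 2` is `∅`-algebraic in `ℂ_exp`** (no
parameter-free formula isolates a finite non-empty set of branches of `log 2`) — the route's
informal kill criterion for (A), with SC replaced by (R). -/
theorem logTwoBranch_not_mem_expAcl_of_cruxes (hA : RigidCore.AclSubsetLogFreeCore)
    (hR : RigidCore.SchanuelOnLogFreeCore) (k : ℤ) :
    ((Real.log 2 : ℝ) : ℂ) + k * (2 * Real.pi * Complex.I) ∉ expAcl := by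
  rcases logFree_or_branches_disjoint_acl_of_crux hA with h | h
  · exact absurd h (log_two_not_mem_core_of_crux hR)
  · exact h k

end LogFreeOfCrux

end Summit.Schanuel.Schanuel.Theorems.RigidCore

end
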